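import Mathlib
import Summits.QuantumFields.QCD.Theorems.QuarksAsStableActionUnquenchedChessboardBoundStubMarginalRPGram
import Summits.QuantumFields.QCD.Theorems.QuarksAsStableActionUnquenchedChessboardBoundStubMarginalRPLower
import HarnessLib

/-!
# The Gram identity of the antiperiodic Wilson fermion determinant (stub `stub_marginalRP` of crux
stmt-QuantumFields-9735, line Sketch — helper file 5)

We index the UPPER class `upIdx` of the site × colour × spin indices of the even four-torus by
`Fin n` (`upEnum`), identify the whole index set with `Fin n ⊕ Fin n` through
`i ↦ upper index`, `i ↦ σπ(upper index)` (`blockEquiv`), and obtain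

* `det_wilsonDiracAP_eq_det_fromBlocks`:
  `det D_AP[U] = det [[P(U), C(U)], [C(U), diag v · P(Θ'U)ᴴ · diag u]]` with the upper block
  `P(U)_{ij} = D'(eᵢ, π eⱼ)` (`upperBlock`), the plane block `C(U)_{ij} = [eᵢ, eⱼ plane] D'(eᵢ, eⱼ)`
  (`planeBlock`) and the phases of `StubMarginalRPLower`;
* **`det_wilsonDiracAP_eq_gram`** (single-flavour Gram identity):
  `det D_AP[U] = Σ_{I,J} K(U)_{I,J} ρ(P(U))_{I} conj ρ(P(Θ'U))_{J}` over pairs of finsets, with the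
  kernel `K(U)_{(Z,W),(T,S)} = Γ(C(U))_{T,Z} Γ(C(U))_{W,S}` (`gramKernel`), by the Gram expansion
  `det_fromBlocks_eq_sum_rho` of helper file 1.
-/

noncomputable section

open Matrix Complex Finset
open Literature.MathematicalPhysics.QuantumLattice Literature.MathematicalPhysics.QuantumFieldTheory
open Literature.Probability.LatticeModels
open scoped ComplexConjugate BigOperators Kronecker

namespace Summit.QuantumFields.QCD.Theorems.UnquenchedChessboardBoundLine

section Setup

variable {L N : ℕ} [NeZero L] [Fact (1 < L)]

/-! ## Enumerating the upper class -/

/-- The number of upper indices. -/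
def upCard (L N : ℕ) [NeZero L] : ℕ := (upIdx : Finset (TorusSite 4 L × Fin N × Fin 4)).card

/-- The enumeration of the upper indices. -/
def upEnum (L N : ℕ) [NeZero L] (i : Fin (upCard L N)) : TorusSite 4 L × Fin N × Fin 4 :=
  ((upIdx : Finset (TorusSite 4 L × Fin N × Fin 4)).equivFin.symm i : _)

omit [Fact (1 < L)] in
/-- The enumeration lands in the upper class. -/
theorem upEnum_mem (i : Fin (upCard L N)) : upEnum L N i ∈ upIdx :=
  ((upIdx : Finset (TorusSite 4 L × Fin N × Fin 4)).equivFin.symm i).2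

/-- **The block identification** `Fin n ⊕ Fin n ≃ indices`: upper indices, then their images under
`σπ` (which exhaust the complement of the upper class). -/
def blockEquiv (hL : Even L) (h4 : 4 ≤ L) :
    (Fin (upCard L N) ⊕ Fin (upCard L N)) ≃ (TorusSite 4 L × Fin N × Fin 4) where
  toFun := Sum.elim (upEnum L N) (fun i => sigmaMap (piMap (upEnum L N i)))
  invFun q := if h : q ∈ upIdx then Sum.inl ((upIdx).equivFin ⟨q, h⟩)
    else Sum.inr ((upIdx).equivFin ⟨sigmaMap (piMap q), (mem_upIdx_sigmaPi_iff hL h4 q).2 h⟩)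
  left_inv := by
    rintro (i | i)
    · simp only [Sum.elim_inl]
      rw [dif_pos (upEnum_mem i)]
      simp [upEnum]
    · have hn : sigmaMap (piMap (upEnum L N i)) ∉ upIdx :=
        fun h => (mem_upIdx_sigmaPi_iff hL h4 _).1 h (upEnum_mem i)
      simp only [Sum.elim_inr]
      rw [dif_neg hn]
      simp [sigmaPi_sigmaPi hL, upEnum]
  right_inv q := by
    by_cases h : q ∈ upIdx
    · simp only [dif_pos h, Sum.elim_inl, upEnum, Equiv.symm_apply_apply]
    · simp only [dif_neg h, Sum.elim_inr, upEnum, Equiv.symm_apply_apply, sigmaPi_sigmaPi hL]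

/-- The plane flip as a permutation of the indices. -/
def piPerm : Equiv.Perm (TorusSite 4 L × Fin N × Fin 4) :=
  Function.Involutive.toPerm piMap piMap_piMap

/-- The chirality flip as a permutation of `Fin 4`. -/
def sflipPerm : Equiv.Perm (Fin 4) := Function.Involutive.toPerm sflip sflip_sflip

/-- `sflip = (0 2)(1 3)` is even. -/
theorem sign_sflipPerm : Equiv.Perm.sign sflipPerm = 1 := by decide

omit [Fact (1 < L)] in
/-- **The plane flip is an even permutation** (a product of the even `sflip` over the plane
site–colour pairs). -/
theorem sign_piPerm : Equiv.Perm.sign (piPerm (L := L) (N := N)) = 1 := by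
  have heq : (piPerm (L := L) (N := N)) = Equiv.prodCongrRight fun x : TorusSite 4 L =>
      if tv x = 0 ∨ tv x = L / 2 then Equiv.prodCongrRight (fun _ : Fin N => sflipPerm) else 1 := by
    ext1 ⟨x, a, α⟩
    change piMap (x, a, α) = _
    by_cases h : tv x = 0 ∨ tv x = L / 2
    · rw [piMap_of_mem (mem_planeIdx.2 h)]
      simp [h, flipSpin, sflipPerm]
    · rw [piMap_of_not_mem (fun h' => h (mem_planeIdx.1 h'))]
      simp [h]
  rw [heq, Equiv.Perm.sign_prodCongrRight]
  refine Finset.prod_eq_one fun x _ => ?_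
  split_ifs
  · rw [Equiv.Perm.sign_prodCongrRight]
    exact Finset.prod_eq_one fun _ _ => sign_sflipPerm
  · exact Equiv.Perm.sign_one

/-! ## The blocks -/

/-- The upper block `P(U)_{ij} = D'[apLift U](eᵢ, π eⱼ)`. -/
def upperBlock (U : GaugeConfig 4 L (Matrix.specialUnitaryGroup (Fin N) ℂ)) (m : ℝ) :
    Matrix (Fin (upCard L N)) (Fin (upCard L N)) ℂ :=
  Matrix.of fun i j => wilsonDiracG (unitaryFundamentalRep (Fin N) ℂ) chiralGamma (apLift U) m 1
    (upEnum L N i) (piMap (upEnum L N j))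

/-- The plane block `C(U)_{ij} = [eᵢ, eⱼ plane] D'[apLift U](eᵢ, eⱼ)`. -/
def planeBlock (U : GaugeConfig 4 L (Matrix.specialUnitaryGroup (Fin N) ℂ)) (m : ℝ) :
    Matrix (Fin (upCard L N)) (Fin (upCard L N)) ℂ :=
  Matrix.of fun i j => if upEnum L N i ∈ planeIdx ∧ upEnum L N j ∈ planeIdx then
    wilsonDiracG (unitaryFundamentalRep (Fin N) ℂ) chiralGamma (apLift U) m 1 (upEnum L N i) (upEnum L N j)
    else 0

/-- The row phases on the enumeration. -/
def vVec (L N : ℕ) [NeZero L] (i : Fin (upCard L N)) : ℂ := vPhase (upEnum L N i)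

/-- The column phases on the enumeration. -/
def uVec (L N : ℕ) [NeZero L] (i : Fin (upCard L N)) : ℂ := uPhase (upEnum L N i)

/-- **The block form of the antiperiodic Wilson fermion determinant**:
`det D_AP[U] = det [[P(U), C(U)], [C(U), diag v · P(Θ'U)ᴴ · diag u]]`. -/
theorem det_wilsonDiracAP_eq_det_fromBlocks (hL : Even L) (h4 : 4 ≤ L)
    (U : GaugeConfig 4 L (Matrix.specialUnitaryGroup (Fin N) ℂ)) (m : ℝ) :
    (wilsonDiracAP U m).det =
      (fromBlocks (upperBlock U m) (planeBlock U m) (planeBlock U m)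
        (diagonal (vVec L N) * (upperBlock (GaugeConfig.negReflect U) m)ᴴ * diagonal (uVec L N))).det := by
  set D := wilsonDiracG (unitaryFundamentalRep (Fin N) ℂ) chiralGamma (apLift U) m 1 with hD
  have h1 : (wilsonDiracAP U m).det = D.det := by
    rw [wilsonDiracAP_def, hD, det_wilsonDiracG_chiral]
  have h2 : D.det = (D.submatrix (blockEquiv hL h4) (piPerm ∘ blockEquiv hL h4)).det := by
    rw [show D.submatrix (blockEquiv hL h4) (piPerm ∘ blockEquiv hL h4) =
      (D.submatrix id piPerm).submatrix (blockEquiv hL h4) (blockEquiv hL h4) by rfl,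
      det_submatrix_equiv_self, det_permute', sign_piPerm, Units.val_one, Int.cast_one, one_mul]
  rw [h1, h2]
  congr 1
  ext (i | i) (j | j) <;>
    simp only [Matrix.submatrix_apply, Function.comp_apply, fromBlocks_apply₁₁, fromBlocks_apply₁₂,
      fromBlocks_apply₂₁, fromBlocks_apply₂₂, blockEquiv, Equiv.coe_fn_mk, Sum.elim_inl, Sum.elim_inr, piPerm,
      Function.Involutive.coe_toPerm]
  · rfl
  · rw [piMap_sigmaMap hL, piMap_piMap, hD, crossBlock₁_entry _ hL h4 _ m (upEnum_mem i) (upEnum_mem j)]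
    rfl
  · rw [hD, crossBlock₂_entry _ hL h4 _ m (upEnum_mem i) (upEnum_mem j)]
    rfl
  · rw [piMap_sigmaMap hL, piMap_piMap, hD, lowerBlock_entry, mul_diagonal, diagonal_mul, conjTranspose_apply,
      ← starRingEnd_apply]
    simp only [vVec, uVec, upperBlock, Matrix.of_apply]
    ring

/-! ## The Gram identity -/

/-- The enumerated plane indices. -/
def planeFin (L N : ℕ) [NeZero L] : Finset (Fin (upCard L N)) := Finset.univ.filter fun i => upEnum L N i ∈ planeIdx

omit [Fact (1 < L)] in
/-- A minor of the plane block with a row or a column off the planes vanishes. -/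
theorem Gamma_planeBlock_eq_zero (U : GaugeConfig 4 L (Matrix.specialUnitaryGroup (Fin N) ℂ)) (m : ℝ)
    {W S : Finset (Fin (upCard L N))} (h : ¬ (W ⊆ planeFin L N ∧ S ⊆ planeFin L N)) :
    Gamma (planeBlock U m) W S = 0 := by
  by_cases hc : W.card = S.card
  · rw [Gamma_apply_of_card_eq _ (k := S.card) hc rfl]
    rcases not_and_or.1 h with hW | hS
    · obtain ⟨w, hwW, hw⟩ := Finset.not_subset.1 hW
      have hw' : upEnum L N w ∉ planeIdx := fun h' => hw (by simp [planeFin, h'])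
      refine det_eq_zero_of_row_eq_zero ((W.orderIsoOfFin hc).symm ⟨w, hwW⟩) fun b => ?_
      have : W.orderEmbOfFin hc ((W.orderIsoOfFin hc).symm ⟨w, hwW⟩) = w := by
        rw [← Finset.coe_orderIsoOfFin_apply, OrderIso.apply_symm_apply]
      rw [submatrix_apply, this, planeBlock, Matrix.of_apply, if_neg (fun h' => hw' h'.1)]
    · obtain ⟨s, hsS, hs⟩ := Finset.not_subset.1 hS
      have hs' : upEnum L N s ∉ planeIdx := fun h' => hs (by simp [planeFin, h'])
      refine det_eq_zero_of_column_eq_zero ((S.orderIsoOfFin rfl).symm ⟨s, hsS⟩) fun a => ?_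
      have : S.orderEmbOfFin rfl ((S.orderIsoOfFin rfl).symm ⟨s, hsS⟩) = s := by
        rw [← Finset.coe_orderIsoOfFin_apply, OrderIso.apply_symm_apply]
      rw [submatrix_apply, this, planeBlock, Matrix.of_apply, if_neg (fun h' => hs' h'.2)]
  · exact Gamma_apply_of_card_ne _ hc

omit [Fact (1 < L)] in
/-- On the enumerated plane indices `v = u = -i`. -/
theorem vVec_uVec_of_mem (hL : Even L) (h4 : 4 ≤ L) {i : Fin (upCard L N)} (hi : i ∈ planeFin L N) :
    vVec L N i = -I ∧ uVec L N i = -I := by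
  have hi' : upEnum L N i ∈ planeIdx := by simpa [planeFin] using hi
  exact ⟨vPhase_of_mem (upEnum_mem i) hi' hL h4, uPhase_of_mem (upEnum_mem i) hi' hL h4⟩

omit [Fact (1 < L)] in
/-- `∏ᵢ vᵢ uᵢ = 1` on the enumeration. -/
theorem prod_vVec_mul_uVec (hL : Even L) (h4 : 4 ≤ L) : (∏ i, vVec L N i) * ∏ i, uVec L N i = 1 := by
  rw [← Finset.prod_mul_distrib]
  have key := prod_upIdx_vPhase_mul_uPhase (L := L) (N := N) hL h4
  rw [← Finset.prod_coe_sort] at key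
  rw [← key]
  exact Fintype.prod_equiv ((upIdx : Finset (TorusSite 4 L × Fin N × Fin 4)).equivFin.symm) _ _ fun i => rfl

omit [Fact (1 < L)] in
/-- **The reflected term**: for `S, T` on the planes with `|S| = |T|`,
`(-1)^{|S|} ρ(Q)_{S,T} = conj ρ(P(Θ'U))_{T,S}` for the lower block `Q = diag v P(Θ'U)ᴴ diag u`. -/
theorem neg_pow_mul_rho_lowerBlock (hL : Even L) (h4 : 4 ≤ L)
    (U : GaugeConfig 4 L (Matrix.specialUnitaryGroup (Fin N) ℂ)) (m : ℝ)
    {S T : Finset (Fin (upCard L N))} (hS : S ⊆ planeFin L N) (hT : T ⊆ planeFin L N) (hc : S.card = T.card) :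
    (-1) ^ S.card * rho (diagonal (vVec L N) * (upperBlock (GaugeConfig.negReflect U) m)ᴴ * diagonal (uVec L N)) S T =
      conj (rho (upperBlock (GaugeConfig.negReflect U) m) T S) := by
  have hv : ∀ i, vVec L N i ≠ 0 := fun i => by
    unfold vVec vPhase timeSign
    refine mul_ne_zero (by split_ifs <;> norm_num) ?_
    rw [map_ne_zero_iff _ (RingHom.injective _)]
    generalize (piMap (upEnum L N i)).2.2 = α
    fin_cases α <;> simp [chi]
  have hu : ∀ i, uVec L N i ≠ 0 := fun i => by
    unfold uVec uPhase timeSign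
    refine mul_ne_zero (by split_ifs <;> norm_num) ?_
    generalize (upEnum L N i).2.2 = α
    fin_cases α <;> simp [chi]
  rw [rho_diagonal_mul_mul_diagonal _ _ hv hu, prod_vVec_mul_uVec hL h4, one_mul, rho_conjTranspose]
  have h1 : ∏ s ∈ S, (uVec L N s)⁻¹ = I ^ S.card := by
    rw [Finset.prod_congr rfl fun s hs => by rw [(vVec_uVec_of_mem hL h4 (hS hs)).2], Finset.prod_const]
    congr 1
    rw [inv_eq_iff_eq_inv]; simp
  have h2 : ∏ t ∈ T, (vVec L N t)⁻¹ = I ^ T.card := by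
    rw [Finset.prod_congr rfl fun t ht => by rw [(vVec_uVec_of_mem hL h4 (hT ht)).1], Finset.prod_const]
    congr 1
    rw [inv_eq_iff_eq_inv]; simp
  rw [h1, h2, ← hc, ← mul_assoc, ← mul_assoc, ← mul_pow, ← mul_pow,
    show (-1 : ℂ) * I * I = 1 by rw [mul_assoc, Complex.I_mul_I]; norm_num, one_pow, one_mul]

/-- The Gram kernel `K(U)_{(Z,W),(T,S)} = Γ(C(U))_{T,Z} · Γ(C(U))_{W,S}` on pairs of finsets. -/
def gramKernel (U : GaugeConfig 4 L (Matrix.specialUnitaryGroup (Fin N) ℂ)) (m : ℝ) :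
    Matrix (Finset (Fin (upCard L N)) × Finset (Fin (upCard L N)))
      (Finset (Fin (upCard L N)) × Finset (Fin (upCard L N))) ℂ :=
  (Gamma (planeBlock U m))ᵀ ⊗ₖ Gamma (planeBlock U m)

end Setup

/-- **The single-flavour Gram identity**: the antiperiodic Wilson fermion determinant is a
kernel pairing of the row-replacement minors of the upper block of `U` with the conjugates of those
of the reflected field `Θ'U`. -/
theorem det_wilsonDiracAP_eq_gram {L N : ℕ} [NeZero L] [Fact (1 < L)] (hL : Even L) (h4 : 4 ≤ L)
    (U : GaugeConfig 4 L (Matrix.specialUnitaryGroup (Fin N) ℂ)) (m : ℝ) :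
    (wilsonDiracAP U m).det =
      ∑ I : Finset (Fin (upCard L N)) × Finset (Fin (upCard L N)),
        ∑ J : Finset (Fin (upCard L N)) × Finset (Fin (upCard L N)),
          gramKernel U m I J * rho (upperBlock U m) I.1 I.2 *
            conj (rho (upperBlock (GaugeConfig.negReflect U) m) J.1 J.2) := by
  rw [det_wilsonDiracAP_eq_det_fromBlocks hL h4, det_fromBlocks_eq_sum_rho]
  simp only [Fintype.sum_prod_type]
  conv_lhs => rw [Finset.sum_comm]
  conv_lhs => arg 2; ext W; rw [Finset.sum_comm]
  conv_lhs => arg 2; ext W; arg 2; ext Z; rw [Finset.sum_comm]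
  rw [Finset.sum_comm]
  refine Finset.sum_congr rfl fun Z _ => Finset.sum_congr rfl fun W _ =>
    Finset.sum_congr rfl fun T _ => Finset.sum_congr rfl fun S _ => ?_
  simp only [gramKernel, Matrix.kroneckerMap_apply, Matrix.transpose_apply]
  by_cases hWS : W ⊆ planeFin L N ∧ S ⊆ planeFin L N
  swap
  · rw [Gamma_planeBlock_eq_zero U m hWS]; ring
  by_cases hTZ : T ⊆ planeFin L N ∧ Z ⊆ planeFin L N
  swap
  · rw [Gamma_planeBlock_eq_zero U m hTZ]; ring
  by_cases hc : S.card = T.card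
  swap
  · rw [rho_of_card_ne hc, rho_of_card_ne (Ne.symm hc), map_zero]; ring
  rw [neg_pow_mul_rho_lowerBlock hL h4 U m hWS.2 hTZ.1 hc]
  ring

end Summit.QuantumFields.QCD.Theorems.UnquenchedChessboardBoundLine

end
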